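import Literature.NumberTheory.EllipticCurves.DeShalit1987.KatzDistributionFromLMeasure
import Literature.NumberTheory.GaloisRepresentations.FrobeniusDensity
import Literature.NumberTheory.Automorphic.ChebotarevArtinRepHolds
import Literature.NumberTheory.GaloisRepresentations.WeilLAdicCharacterProofs
import HarnessLib

/-!
# The range of de Shalit's (49)–(50) on the Galois group is rigid: relative avatars are unique
# (Chebotarev), so `IsLMeasure` may be checked at ONE avatar per character — proofs only

`DeShalit1987.IsLMeasure ι v v̄ S Ω δ Ω_p 𝒰 μ` (`KatzDistributionFromLMeasure.lean`) asks the integral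
identity (49)–(50) for EVERY `p`-adic avatar `e` OUTSIDE `S` (`IsPAdicAvatarOutside S ι ε e`: the Serre
dictionary only at the places `w ∉ S`, `w ∤ p`) of every in-range Hecke character `ε` — the form
stable under the twists by characters ramified inside `S` that the derivation
`IsLMeasure.isKatzDistribution₂` uses. For whoever CONSTRUCTS the measure (de Shalit II.4.4–4.14)
this looks like more than Thm. 4.14 asserts; it is not: by Chebotarev's density theorem (the tree's
`Automorphic.chebotarev_artinRep_holds`, `absoluteGaloisGroup.frobenius_dense`) a continuous
`Γ_K → GL₁(ℚ̄_p)` is determined by its Frobenii off any finite set, so a relative avatar IS the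
avatar (`IsPAdicAvatarOutside.unique`, `IsPAdicAvatarOutside.eq_of_isPAdicAvatarOf`), and since every
in-range `ε` (type `(−m, j)`) is algebraic it HAS an avatar (Weil, `HeckeCharacter.IsAlgebraic.exists_lAdic`,
proved in the tree). Hence **`DeShalit1987.isLMeasure_iff_isPAdicAvatarOf`**: `IsLMeasure` is
equivalent to the same statement with the absolute dictionary `IsPAdicAvatarOf` — the producer checks
(49)–(50) at the true avatar `ε̂_{dS}⁻¹` only.

THEOREMS ONLY (no definition, no named fact, no `sorry`, no instance).

## References

* [deShalit1987] E. de Shalit, *Iwasawa theory of elliptic curves with complex multiplication* (1987),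
  II.4.13 (p. 69: "any grossencharacter of type `A₀` … may be regarded as a `p`-adic character of `𝒢`"),
  II.4.16 (49)–(50) (p. 76–77).
* [SerreAbelianLadic1968] J.-P. Serre, *Abelian ℓ-adic representations*, Ch. I §2.2 Cor. 2, §2.3, Ch. II §2.7.
* [Weil1956] A. Weil, *On a certain type of characters of the idèle-class group*.
-/

noncomputable section

open scoped Classical
open Filter Polynomial
open NumberField IsDedekindDomain Field
open Literature.NumberTheory.GaloisRepresentations

namespace Literature.NumberTheory.EllipticCurves

variable {p : ℕ} [hp : Fact p.Prime] {K : Type} [Field K] [NumberField K]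
  {S : Finset (HeightOneSpectrum (𝓞 K))} {ι : PadicAlgCl p ≃+* ℂ}

/-! ### §1. Relative avatars are unique (Chebotarev) -/

/-- **Two avatars outside `S` of the same Hecke character coincide** (`Γ_K → GL₁(ℚ̄_p)` continuous,
equal at the arithmetic Frobenii above the cofinitely many `w ∉ S`, `w ∤ p` where the character is
unramified; such Frobenii are dense by Chebotarev). [cite: SerreAbelianLadic1968, Ch. I §2.2 Cor. 2 and §2.3]
[cite: deShalit1987, II.4.13 (p. 69)] -/
theorem IsPAdicAvatarOutside.unique {φ : HeckeCharacter K} {r r' : FramedGaloisRep K (PadicAlgCl p) 1}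
    (hr : IsPAdicAvatarOutside S ι φ r) (hr' : IsPAdicAvatarOutside S ι φ r') : r = r' := by
  -- the exceptional set: `S`, the places above `p`, the ramified places of `φ`
  set T : Set (HeightOneSpectrum (𝓞 K)) :=
    {v | v ∈ S ∨ ((p : ℕ) : 𝓞 K) ∈ v.asIdeal ∨ ¬ φ.IsUnramifiedAt v} with hT
  have hTf : T.Finite := by
    refine ((S.finite_toSet.union
      (IsDedekindDomain.HeightOneSpectrum.finite_setOf_natCast_mem (R := 𝓞 K) hp.out.ne_zero)).union
      (HeckeCharacter.finite_ramifiedPlaces_holds φ)).subset ?_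
    rintro v (hv | hv | hv)
    · exact Or.inl (Or.inl hv)
    · exact Or.inl (Or.inr hv)
    · exact Or.inr hv
  have hdense := absoluteGaloisGroup.frobenius_dense
    Literature.NumberTheory.Automorphic.chebotarev_artinRep_holds K T hTf
  have hclosed : IsClosed {σ : absoluteGaloisGroup K |
      ((r σ : GL (Fin 1) (PadicAlgCl p)) : Matrix (Fin 1) (Fin 1) (PadicAlgCl p)) =
        ((r' σ : GL (Fin 1) (PadicAlgCl p)) : Matrix (Fin 1) (Fin 1) (PadicAlgCl p))} :=
    isClosed_eq (Units.continuous_val.comp r.continuous) (Units.continuous_val.comp r'.continuous)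
  have hsub : {σ : absoluteGaloisGroup K | ∃ v ∉ T, ∃ 𝔓 ∈ v.primesAbove, IsArithFrobAt (𝓞 K) σ 𝔓} ⊆
      {σ | ((r σ : GL (Fin 1) (PadicAlgCl p)) : Matrix (Fin 1) (Fin 1) (PadicAlgCl p)) =
        ((r' σ : GL (Fin 1) (PadicAlgCl p)) : Matrix (Fin 1) (Fin 1) (PadicAlgCl p))} := by
    rintro σ ⟨v, hv, 𝔓, h𝔓, hσ⟩
    simp only [hT, Set.mem_setOf_eq, not_or, not_not] at hv
    obtain ⟨hvS, hvp, hφ⟩ := hv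
    have h1 := (FramedGaloisRep.hasFrobCharpolyAt_iff_of_rank_one r v _).mp (hr v hvS hvp hφ).2 𝔓 h𝔓 σ hσ
    have h2 := (FramedGaloisRep.hasFrobCharpolyAt_iff_of_rank_one r' v _).mp (hr' v hvS hvp hφ).2 𝔓 h𝔓 σ hσ
    refine Matrix.ext fun i j ↦ ?_
    rw [Subsingleton.elim i 0, Subsingleton.elim j 0, h1, h2]
  have huniv : Set.univ ⊆ {σ | ((r σ : GL (Fin 1) (PadicAlgCl p)) : Matrix (Fin 1) (Fin 1) (PadicAlgCl p)) =
      ((r' σ : GL (Fin 1) (PadicAlgCl p)) : Matrix (Fin 1) (Fin 1) (PadicAlgCl p))} := by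
    rw [← hdense.closure_eq]
    exact hclosed.closure_subset_iff.mpr hsub
  exact ContinuousMonoidHom.ext fun σ ↦ Units.ext (huniv (Set.mem_univ σ))

/-- **A relative avatar is THE avatar**: if `r` is an avatar of `φ` outside `S` and `r₀` an avatar of
`φ` (absolute dictionary), then `r = r₀`. [cite: SerreAbelianLadic1968, Ch. I §2.3, Ch. II §2.7] -/
theorem IsPAdicAvatarOutside.eq_of_isPAdicAvatarOf {φ : HeckeCharacter K}
    {r r₀ : FramedGaloisRep K (PadicAlgCl p) 1} (hr : IsPAdicAvatarOutside S ι φ r)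
    (hr₀ : IsPAdicAvatarOf ι φ r₀) : r = r₀ :=
  hr.unique (hr₀.isPAdicAvatarOutside S)

/-- **An algebraic Hecke character has exactly one avatar outside `S`, namely Weil's**: for `φ`
algebraic and `r` an avatar outside `S`, `r` is an avatar in the absolute sense.
[cite: Weil1956, §1–§2] [cite: SerreAbelianLadic1968, Ch. II §2.7] -/
theorem IsPAdicAvatarOutside.isPAdicAvatarOf {φ : HeckeCharacter K}
    {r : FramedGaloisRep K (PadicAlgCl p) 1} (hr : IsPAdicAvatarOutside S ι φ r) (hφ : φ.IsAlgebraic) :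
    IsPAdicAvatarOf ι φ r := by
  obtain ⟨r₀, hr₀⟩ := hφ.exists_lAdic ι
  have hr₀' : IsPAdicAvatarOf ι φ r₀ := fun w hw hu ↦ by
    refine ⟨(hr₀ w hw hu).1, ?_⟩
    have h := (hr₀ w hw hu).2
    rwa [map_inv₀] at h
  rwa [hr.eq_of_isPAdicAvatarOf hr₀']

/-! ### §2. `IsLMeasure` may be checked at the absolute avatars only -/

/-- **de Shalit's (49)–(50) on the Galois group, ABSOLUTE-AVATAR FORM ⟺ RELATIVE-AVATAR FORM.** The
predicate `IsLMeasure ι v v̄ S Ω δ Ω_p 𝒰 μ` (integral identity at every avatar outside `S` of every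
in-range `ε`) is equivalent to the same identity demanded only at the avatars in the absolute sense
(`IsPAdicAvatarOf`): an in-range `ε` has type `(−m, j)`, hence is algebraic, hence its relative
avatars are its (unique, Weil) avatar. The producer of de Shalit's measure verifies (36)/(50) at
`e = ε̂_{dS}⁻¹` only. [cite: deShalit1987, II.4.13 (p. 69), II.4.16 (49)–(50) (p. 76–77)]
[cite: SerreAbelianLadic1968, Ch. II §2.7] -/
theorem DeShalit1987.isLMeasure_iff_isPAdicAvatarOf {v vbar : HeightOneSpectrum (𝓞 K)} {Ω δ : ℂ}
    {Ωp : ℂ_[p]} {𝒰 : SubgroupTower (absoluteGaloisGroup K)} {μ : GroupDistribution 𝒰 ℂ_[p]} :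
    DeShalit1987.IsLMeasure ι v vbar S Ω δ Ωp 𝒰 μ ↔
      ∀ (ε : HeckeCharacter K) (e : FramedGaloisRep K (PadicAlgCl p) 1) (m j : ℕ),
        IsPAdicAvatarOf ι ε e → j < m →
        ε.HasInfinityType (fun _ ↦ -(m : ℤ)) (fun _ ↦ (j : ℤ)) →
        (∀ w : HeightOneSpectrum (𝓞 K), w ∉ S → w ≠ vbar → ε.IsUnramifiedAt w) →
        𝒰.IsTowerContinuous (fun σ ↦ avatarValueAt e σ) →
        ∀ hL : LFunction.HasEntireContinuation (heckeLFunction ε),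
          μ.integral (fun σ ↦ avatarValueAt e σ) =
            ((ι.symm (DeShalit1987.interpolationValue p v vbar S ε m j Ω δ (hL.continuation 0)) :
                PadicAlgCl p) : ℂ_[p]) * Ωp ^ (m + j) := by
  refine ⟨fun h ε e m j he ↦ h ε e m j (he.isPAdicAvatarOutside S), fun h ε e m j he hjm hinf ↦ ?_⟩
  have halg : ε.IsAlgebraic := (ε.isAlgebraic_iff_exists_hasInfinityType).mpr ⟨_, _, hinf⟩
  exact h ε e m j (he.isPAdicAvatarOf halg) hjm hinf

end Literature.NumberTheory.EllipticCurves

end
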